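import Summits.RiemannHypothesis.RiemannHypothesis.Theorems.WeilFormatCCinfCouplingFamilies
import Literature.NumberTheory.LFunctions.WeilMarkovQuadratic
import Mathlib.Analysis.SpecialFunctions.Log.Basic
import HarnessLib

/-!
# Format C, design C∞ (E3, analytic side): TRUNCATING a collected object — high powers go into the remainder

Route context: Fourier–Galerkin / Schur-complement certificates of Weil positivity on a window ("format C", C∞ door;
cell memo `run/shared/lean/pub/rh-explicit/rh-explicit-weil-10/KERNEL-LEVER.md` §21; supporting stmt-RiemannHypothesis-0098;
seat rh-explicit-weil-10).  The collected monomial forms (`…_sub_family_le`) run over the family index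
`Fin 4 × Fin (D+1)` with the collection depth `D` dictated by the expansion orders (`D ≈ K + 2J`), although the
remainder weight is only `(m₀/m)^{E+1}`.  Every monomial of power `d ≥ E + 2` is itself below the remainder scale:
`|c·T(m)/m^d| ≤ |c|·τ_T/m₀^{d}·(m₀/m)^{E+1}` (`τ = 1, m₀, ΛΣ, ΛΣ` for the tags `1, log m, −C_m, S_m`, using
`log m ≤ m`, `|C_m|, |S_m| ≤ ΛΣ = Σ_{n∈P(a)} Λ(n)n^{-1/2}`).  So the coefficients of power `> E₀` (`E₀ ≥ E + 1`) may be
ZEROED, their total size joining the remainder constant — the family Gram data then only matter up to power `E₀`: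

* `abs_tag_le` — `|(1, log m, −C_m, S_m)_t| ≤ (1, m, ΛΣ, ΛΣ)_t` (`m ≥ 1`);
* `collected_truncate` — `|X − ε Σ_x A(x)φ_x(m)| ≤ ρ·(m₀/m)^{E+1}` ⟹
  `|X − ε Σ_x A⁰(x)φ_x(m)| ≤ (ρ + Σ_{x, x.2 > E₀} |A(x)|·τ_{x.1}/m₀^{x.2})·(m₀/m)^{E+1}`, `A⁰ = A·[x.2 ≤ E₀]`.

Elementary; standard axioms; no definitions; no RH claim.
-/

set_option autoImplicit false
-- `Summit.RiemannHypothesis.RiemannHypothesis.…` is the layout-mandated namespace (summit = problem name).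
set_option linter.dupNamespace false

noncomputable section

open Finset
open scoped BigOperators Real ArithmeticFunction.vonMangoldt

namespace Summit.RiemannHypothesis.RiemannHypothesis.Theorems.WeilFormatC

open Literature.NumberTheory.LFunctions

variable {a : ℝ}

/-- The prime sums are bounded by `ΛΣ = Σ_{n∈P(a)} Λ(n)n^{-1/2}`. -/
theorem abs_primeTrigSum_le (a ω : ℝ) (g : ℝ → ℝ) (hg : ∀ y, |g y| ≤ 1) :
    |∑ n ∈ weilPrimeIndex a, (Λ n : ℝ) / Real.sqrt n * g (ω * Real.log n)|
      ≤ ∑ n ∈ weilPrimeIndex a, (Λ n : ℝ) / Real.sqrt n := by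
  refine (Finset.abs_sum_le_sum_abs _ _).trans (Finset.sum_le_sum fun n _ ↦ ?_)
  rw [abs_mul, abs_of_nonneg (div_nonneg ArithmeticFunction.vonMangoldt_nonneg (Real.sqrt_nonneg _))]
  exact mul_le_of_le_one_right (div_nonneg ArithmeticFunction.vonMangoldt_nonneg (Real.sqrt_nonneg _)) (hg _)

/-- **Tag bounds**: `|(1, log m, −C_m, S_m)_t| ≤ (1, m, ΛΣ, ΛΣ)_t` for `m ≥ 1`. -/
theorem abs_tag_le (a : ℝ) {m : ℝ} (hm : 1 ≤ m) (t : Fin 4) :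
    |(![(1 : ℝ), Real.log m, -(∑ n ∈ weilPrimeIndex a, (Λ n : ℝ) / Real.sqrt n * Real.cos (π * m / a * Real.log n)),
        (∑ n ∈ weilPrimeIndex a, (Λ n : ℝ) / Real.sqrt n * Real.sin (π * m / a * Real.log n))] t)|
      ≤ ![(1 : ℝ), m, ∑ n ∈ weilPrimeIndex a, (Λ n : ℝ) / Real.sqrt n,
          ∑ n ∈ weilPrimeIndex a, (Λ n : ℝ) / Real.sqrt n] t := by
  fin_cases t
  · simp
  · simp only [Fin.mk_one, Matrix.cons_val_one, Matrix.cons_val_zero]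
    rw [abs_of_nonneg (Real.log_nonneg hm)]
    exact (Real.log_le_sub_one_of_pos (by linarith)).trans (by linarith)
  · simp only [Fin.reduceFinMk, Matrix.cons_val, abs_neg]
    exact abs_primeTrigSum_le a _ Real.cos (fun y ↦ Real.abs_cos_le_one y)
  · simp only [Fin.reduceFinMk, Matrix.cons_val]
    exact abs_primeTrigSum_le a _ Real.sin (fun y ↦ Real.abs_sin_le_one y)

/-- One high monomial is below the remainder scale: for `0 < m₀ ≤ m`, `E + 2 ≤ d`, `0 ≤ τ ≤ τ'·(m/m₀)`:
`|c|·τ/m^d ≤ |c|·τ'/m₀^d·(m₀/m)^{E+1}` (covers `τ' = m₀` for the `log` tag via `log m ≤ m`, and `τ' = τ` for bounded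
tags). -/
theorem high_monomial_le {c τ τ' m₀ m : ℝ} (hm₀ : 0 < m₀) (hm : m₀ ≤ m) (hτ : 0 ≤ τ) (hττ : τ ≤ τ' * (m / m₀))
    {E d : ℕ} (hd : E + 2 ≤ d) :
    |c| * τ / m ^ d ≤ |c| * τ' / m₀ ^ d * (m₀ / m) ^ (E + 1) := by
  have hm' : 0 < m := hm₀.trans_le hm
  have hτ' : 0 ≤ τ' := by
    rcases le_or_gt 0 τ' with h0 | h0
    · exact h0
    · have : τ' * (m / m₀) < 0 := mul_neg_of_neg_of_pos h0 (div_pos hm' hm₀)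
      linarith
  obtain ⟨d', rfl⟩ : ∃ d', d = d' + (E + 2) := ⟨d - (E + 2), by omega⟩
  have key : τ / m ^ (d' + (E + 2)) ≤ τ' / m₀ ^ (d' + (E + 2)) * (m₀ / m) ^ (E + 1) := by
    have e1 : τ' / m₀ ^ (d' + (E + 2)) * (m₀ / m) ^ (E + 1) = τ' / (m₀ ^ (d' + 1) * m ^ (E + 1)) := by
      rw [div_pow, pow_add m₀ d' (E + 2), pow_add m₀ (E + 1) 1, pow_add m₀ d' 1]
      field_simp
    rw [e1]
    have hden : m₀ ^ (d' + 1) * m ^ (E + 1) ≤ m₀ * m ^ (d' + (E + 1)) :=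
      calc m₀ ^ (d' + 1) * m ^ (E + 1) = m₀ * (m₀ ^ d' * m ^ (E + 1)) := by ring
        _ ≤ m₀ * (m ^ d' * m ^ (E + 1)) := mul_le_mul_of_nonneg_left
            (mul_le_mul_of_nonneg_right (pow_le_pow_left₀ hm₀.le hm d') (pow_nonneg hm'.le _)) hm₀.le
        _ = m₀ * m ^ (d' + (E + 1)) := by rw [← pow_add]
    calc τ / m ^ (d' + (E + 2)) ≤ τ' * (m / m₀) / m ^ (d' + (E + 2)) :=
          div_le_div_of_nonneg_right hττ (pow_nonneg hm'.le _)
      _ = τ' / (m₀ * m ^ (d' + (E + 1))) := by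
          rw [show d' + (E + 2) = (d' + (E + 1)) + 1 by ring, pow_succ]
          field_simp
      _ ≤ τ' / (m₀ ^ (d' + 1) * m ^ (E + 1)) :=
          div_le_div_of_nonneg_left hτ' (by positivity) hden
  have := mul_le_mul_of_nonneg_left key (abs_nonneg c)
  calc |c| * τ / m ^ (d' + (E + 2)) = |c| * (τ / m ^ (d' + (E + 2))) := by ring
    _ ≤ |c| * (τ' / m₀ ^ (d' + (E + 2)) * (m₀ / m) ^ (E + 1)) := this
    _ = _ := by ring

/-- **Truncation of a collected object** (`1 ≤ m₀ ≤ m`, `E + 1 ≤ E₀`, `|ε| ≤ 1`): zeroing the coefficients of power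
`> E₀` costs `Σ_{x, x.2 > E₀} |A(x)|·(1, m₀, ΛΣ, ΛΣ)_{x.1}/m₀^{x.2}` on the remainder constant. -/
theorem collected_truncate {X ε ρ : ℝ} {m₀ m : ℕ} (hm₀ : 1 ≤ m₀) (hm : m₀ ≤ m) {D E E₀ : ℕ} (hE : E + 1 ≤ E₀)
    (hε : |ε| ≤ 1) (A : Fin 4 × Fin (D + 1) → ℝ)
    (h : |X - ε * ∑ x : Fin 4 × Fin (D + 1), A x *
        (![(1 : ℝ), Real.log m, -(∑ n ∈ weilPrimeIndex a, (Λ n : ℝ) / Real.sqrt n * Real.cos (π * m / a * Real.log n)),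
          (∑ n ∈ weilPrimeIndex a, (Λ n : ℝ) / Real.sqrt n * Real.sin (π * m / a * Real.log n))] x.1
          / (m : ℝ) ^ (x.2 : ℕ))| ≤ ρ * ((m₀ : ℝ) / m) ^ (E + 1)) :
    |X - ε * ∑ x : Fin 4 × Fin (D + 1), (if (x.2 : ℕ) ≤ E₀ then A x else 0) *
        (![(1 : ℝ), Real.log m, -(∑ n ∈ weilPrimeIndex a, (Λ n : ℝ) / Real.sqrt n * Real.cos (π * m / a * Real.log n)),
          (∑ n ∈ weilPrimeIndex a, (Λ n : ℝ) / Real.sqrt n * Real.sin (π * m / a * Real.log n))] x.1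
          / (m : ℝ) ^ (x.2 : ℕ))|
      ≤ (ρ + ∑ x : Fin 4 × Fin (D + 1), if E₀ < (x.2 : ℕ) then
          |A x| * (![(1 : ℝ), (m₀ : ℝ), ∑ n ∈ weilPrimeIndex a, (Λ n : ℝ) / Real.sqrt n,
            ∑ n ∈ weilPrimeIndex a, (Λ n : ℝ) / Real.sqrt n] x.1) / (m₀ : ℝ) ^ (x.2 : ℕ) else 0)
        * ((m₀ : ℝ) / m) ^ (E + 1) := by
  have hm₀r : (0 : ℝ) < m₀ := by exact_mod_cast hm₀
  have hmr : (m₀ : ℝ) ≤ m := by exact_mod_cast hm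
  have hm1 : (1 : ℝ) ≤ m := le_trans (by exact_mod_cast hm₀) hmr
  set T : Fin 4 → ℝ := ![(1 : ℝ), Real.log m,
      -(∑ n ∈ weilPrimeIndex a, (Λ n : ℝ) / Real.sqrt n * Real.cos (π * m / a * Real.log n)),
      (∑ n ∈ weilPrimeIndex a, (Λ n : ℝ) / Real.sqrt n * Real.sin (π * m / a * Real.log n))] with hT
  set τ : Fin 4 → ℝ := ![(1 : ℝ), (m₀ : ℝ), ∑ n ∈ weilPrimeIndex a, (Λ n : ℝ) / Real.sqrt n,
      ∑ n ∈ weilPrimeIndex a, (Λ n : ℝ) / Real.sqrt n] with hτ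
  set y : ℝ := ((m₀ : ℝ) / m) ^ (E + 1) with hy
  -- split the full sum into kept + dropped
  have hsplit : ∑ x : Fin 4 × Fin (D + 1), A x * (T x.1 / (m : ℝ) ^ (x.2 : ℕ))
      = ∑ x : Fin 4 × Fin (D + 1), (if (x.2 : ℕ) ≤ E₀ then A x else 0) * (T x.1 / (m : ℝ) ^ (x.2 : ℕ))
        + ∑ x : Fin 4 × Fin (D + 1), (if E₀ < (x.2 : ℕ) then A x else 0) * (T x.1 / (m : ℝ) ^ (x.2 : ℕ)) := by
    rw [← Finset.sum_add_distrib]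
    refine Finset.sum_congr rfl fun x _ ↦ ?_
    by_cases hx : (x.2 : ℕ) ≤ E₀
    · rw [if_pos hx, if_neg (not_lt.2 hx)]; ring
    · rw [if_neg hx, if_pos (not_le.1 hx)]; ring
  -- the dropped part is small
  have hdrop : |ε * ∑ x : Fin 4 × Fin (D + 1), (if E₀ < (x.2 : ℕ) then A x else 0) * (T x.1 / (m : ℝ) ^ (x.2 : ℕ))|
      ≤ (∑ x : Fin 4 × Fin (D + 1), if E₀ < (x.2 : ℕ) then
          |A x| * τ x.1 / (m₀ : ℝ) ^ (x.2 : ℕ) else 0) * y := by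
    rw [abs_mul, Finset.sum_mul]
    refine (mul_le_of_le_one_left (abs_nonneg _) hε).trans
      ((Finset.abs_sum_le_sum_abs _ _).trans (Finset.sum_le_sum fun x _ ↦ ?_))
    by_cases hx : E₀ < (x.2 : ℕ)
    · rw [if_pos hx, if_pos hx, abs_mul, abs_div, abs_of_pos (pow_pos (hm₀r.trans_le hmr) _), ← mul_div_assoc]
      have htag : |T x.1| ≤ τ x.1 * ((m : ℝ) / m₀) := by
        have h1 := abs_tag_le a hm1 x.1
        have hge : (1 : ℝ) ≤ (m : ℝ) / m₀ := by rw [le_div_iff₀ hm₀r]; linarith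
        have hτ0 : 0 ≤ ![(1 : ℝ), (m : ℝ), ∑ n ∈ weilPrimeIndex a, (Λ n : ℝ) / Real.sqrt n,
            ∑ n ∈ weilPrimeIndex a, (Λ n : ℝ) / Real.sqrt n] x.1 := (abs_nonneg _).trans h1
        -- `τ` differs from the bound of `abs_tag_le` only in the `log` slot (`m` there, `m₀·(m/m₀) = m` here)
        have hslot : ![(1 : ℝ), (m : ℝ), ∑ n ∈ weilPrimeIndex a, (Λ n : ℝ) / Real.sqrt n,
            ∑ n ∈ weilPrimeIndex a, (Λ n : ℝ) / Real.sqrt n] x.1 ≤ τ x.1 * ((m : ℝ) / m₀) := by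
          have hΛ : 0 ≤ ∑ n ∈ weilPrimeIndex a, (Λ n : ℝ) / Real.sqrt n :=
            Finset.sum_nonneg fun n _ ↦ div_nonneg ArithmeticFunction.vonMangoldt_nonneg (Real.sqrt_nonneg _)
          rcases x with ⟨t, d⟩
          fin_cases t
          · simp only [hτ]; simp; exact hge
          · simp only [hτ]; simp; rw [mul_div_cancel₀ _ hm₀r.ne']
          · simp only [hτ]; simp; exact le_mul_of_one_le_right hΛ hge
          · simp only [hτ]; simp; exact le_mul_of_one_le_right hΛ hge
        exact h1.trans hslot
      exact high_monomial_le hm₀r hmr (abs_nonneg _) htag (by omega)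
    · rw [if_neg hx, if_neg hx]; simp
  -- assemble
  have hdec : X - ε * ∑ x : Fin 4 × Fin (D + 1), (if (x.2 : ℕ) ≤ E₀ then A x else 0) * (T x.1 / (m : ℝ) ^ (x.2 : ℕ))
      = (X - ε * ∑ x : Fin 4 × Fin (D + 1), A x * (T x.1 / (m : ℝ) ^ (x.2 : ℕ)))
        + ε * ∑ x : Fin 4 × Fin (D + 1), (if E₀ < (x.2 : ℕ) then A x else 0) * (T x.1 / (m : ℝ) ^ (x.2 : ℕ)) := by
    rw [hsplit]; ring
  rw [hdec, add_mul]
  exact (abs_add_le _ _).trans (add_le_add h hdrop)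

end Summit.RiemannHypothesis.RiemannHypothesis.Theorems.WeilFormatC
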